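import Summits.AtomisticToContinuum.HydrodynamicLimit.Theorems.CollisionIsometryCLTDiffuseBackwardInfluenceOnePathBound
import Summits.AtomisticToContinuum.HydrodynamicLimit.Theorems.CollisionIsometryCLTDiffuseBackwardInfluencePairDefs
import Summits.AtomisticToContinuum.HydrodynamicLimit.Theorems.CollisionIsometryCLTDiffuseBackwardInfluencePairGeneric
import HarnessLib

/-!
# `DiffuseBackwardInfluence`, line `share-nondegeneracy-one-flight`, skeleton v7 — helper GEN2: the three one-event
functionals of the marked pair process (stmt-AtomisticToContinuum-12950, for `stub_pairPathBound`)

Generic finite-sum algebra of ONE exchange event (`kstep` / `stepT` / `stepA` of `…PairDefs` §3, marginals `sT` / `sA` of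
`…PairGeneric`), no physics: §W the WEIGHT `Σ λ^s ρ^{-t}·mass` does not increase (geometric supermartingale; registered
headline `pairPath_weight_step`); §SM the SPLIT MOMENT `Σ s·T + Σ (s−1)·A` grows exactly by the re-merge flow; §DF the SCORE
DEFICIT changes by the host charges `(c₀ − e − δ)·T` and by the lag `(c₀ − g)` of the re-merging pairs. Method: a functional
of the stepped profiles is the plain mark sum of the step of REWEIGHTED profiles (`mul_stepT` / `mul_stepA`).
-/

namespace Summit.AtomisticToContinuum.HydrodynamicLimit.Theorems.DiffuseBackwardInfluenceShare

open scoped BigOperators Topology ENNReal InnerProductSpace Classical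
open Filter Set MeasureTheory
open Literature.Analysis.FluidPDE (Config HardSphereFlow collidePair)
open Literature.MathematicalPhysics.KineticTheory (localGibbsLaw hsDiameter)
open Summit.AtomisticToContinuum.HydrodynamicLimit.Theorems.DiffuseBackwardInfluenceNeg

noncomputable section

namespace PairPath

section GenericLemmas

variable {ι : Type*} [DecidableEq ι] [Fintype ι]

/-! ### §W The weight functional `Σ λ^s ρ^{-t} · mass` does not increase -/

/-- Weighted together mass. -/
def wT (lam rho : ℝ) (U : ℕ) (T : ι → ℕ → ℕ → ℝ) : ℝ :=
  ∑ i, ∑ s ∈ Finset.range U, ∑ t ∈ Finset.range U, lam ^ s * rho⁻¹ ^ t * T i s t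

/-- Weighted apart mass. -/
def wA (lam rho : ℝ) (U G : ℕ) (A : ι → ι → ℕ → ℕ → ℕ → ℝ) : ℝ :=
  ∑ i, ∑ j, ∑ s ∈ Finset.range U, ∑ t ∈ Finset.range U, ∑ g ∈ Finset.range (G + 1), lam ^ s * rho⁻¹ ^ t * A i j s t g

/-- A weight through an indicator with empty alternative. -/
private theorem mul_ite_zero {P : Prop} [Decidable P] {c x y : ℝ} (h : P → c * x = y) :
    c * (if P then x else 0) = if P then y else 0 := by
  split_ifs with hP
  exacts [h hP, mul_zero c]

/-- TRANSFER OF A WEIGHT THROUGH `stepT`, source by source: untouched particles, the two hosts, re-merging pairs. -/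
private theorem mul_stepT (p q : ι) (f : ι → ℝ) (δ : ι → ℕ) (G : ℕ) {T T' : ι → ℕ → ℕ → ℝ}
    {A A' : ι → ι → ℕ → ℕ → ℕ → ℝ} {c : ℝ} {i : ι} {s t : ℕ} (h1 : ¬(i = p ∨ i = q) → c * T i s t = T' i s t)
    (hp : δ p ≤ t → c * (kstep p q f p i ^ 2 * T p s (t - δ p)) = kstep p q f p i ^ 2 * T' p s (t - δ p))
    (hq : δ q ≤ t → c * (kstep p q f q i ^ 2 * T q s (t - δ q)) = kstep p q f q i ^ 2 * T' q s (t - δ q))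
    (hA : ∀ i' j' g, c * (A i' j' s t g * (kstep p q f i' i * kstep p q f j' i)) =
      A' i' j' s t g * (kstep p q f i' i * kstep p q f j' i)) :
    c * stepT p q f δ G T A i s t = stepT p q f δ G T' A' i s t := by
  have h1' : c * (if i = p ∨ i = q then 0 else T i s t) = if i = p ∨ i = q then 0 else T' i s t := by
    split_ifs with h
    exacts [mul_zero c, h1 h]
  simp only [stepT, mul_add, Finset.mul_sum, h1', mul_ite_zero hp, mul_ite_zero hq, hA]

/-- TRANSFER OF A WEIGHT THROUGH `stepA`: the transported apart pairs and the splitting pairs of the two hosts. -/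
private theorem mul_stepA (p q : ι) (f : ι → ℝ) (δ : ι → ℕ) (c₀ : ℕ) {T T' : ι → ℕ → ℕ → ℝ}
    {A A' : ι → ι → ℕ → ℕ → ℕ → ℝ} {c : ℝ} {i j : ι} {s t g : ℕ}
    (hA : ∀ i' j', c * (A i' j' s t g * (kstep p q f i' i * kstep p q f j' j)) =
      A' i' j' s t g * (kstep p q f i' i * kstep p q f j' j))
    (hp : g = c₀ ∧ 1 ≤ s → δ p ≤ t → c * (T p (s - 1) (t - δ p) * (kstep p q f p i * kstep p q f p j)) =
      T' p (s - 1) (t - δ p) * (kstep p q f p i * kstep p q f p j))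
    (hq : g = c₀ ∧ 1 ≤ s → δ q ≤ t → c * (T q (s - 1) (t - δ q) * (kstep p q f q i * kstep p q f q j)) =
      T' q (s - 1) (t - δ q) * (kstep p q f q i * kstep p q f q j)) :
    c * stepA p q f δ c₀ T A i j s t g = stepA p q f δ c₀ T' A' i j s t g := by
  unfold stepA
  by_cases hij : i = j
  · rw [if_pos hij, if_pos hij, mul_zero]
  rw [if_neg hij, if_neg hij, mul_add]
  simp only [Finset.mul_sum, hA]
  congr 1
  refine mul_ite_zero fun hgc => ?_
  rw [mul_add, mul_ite_zero (hp hgc), mul_ite_zero (hq hgc)]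

/-- A sum over the particles with the two hosts removed. -/
private theorem sum_ite_pq {p q : ι} (hpq : p ≠ q) (X : ι → ℝ) :
    ∑ i, (if i = p ∨ i = q then 0 else X i) = ∑ i, X i - X p - X q := by
  have h : ∀ i, (if i = p ∨ i = q then 0 else X i) =
      X i - (if i = p then X i else 0) - (if i = q then X i else 0) := by
    intro i
    rcases eq_or_ne i p with rfl | hp
    · simp [hpq]
    rcases eq_or_ne i q with rfl | hq <;> simp [*]
  simp_rw [h, Finset.sum_sub_distrib, Fintype.sum_ite_eq']

/-- A double sum over the particles with the diagonal removed. -/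
private theorem sum_offdiag (Y : ι → ι → ℝ) :
    ∑ i, ∑ j, (if i = j then 0 else Y i j) = ∑ i, ∑ j, Y i j - ∑ i, Y i i := by
  have h : ∀ i j, (if i = j then 0 else Y i j) = Y i j - if i = j then Y i j else 0 := fun i j => by
    split_ifs <;> simp
  simp_rw [h, Finset.sum_sub_distrib, Fintype.sum_ite_eq]

/-- Moving an outer sum inside two sums. -/
private theorem sum₃_comm {α β γ : Type*} (S₁ : Finset α) (S₂ : Finset β) (S₃ : Finset γ) (X : α → β → γ → ℝ) :
    ∑ a ∈ S₁, ∑ b ∈ S₂, ∑ c ∈ S₃, X a b c = ∑ b ∈ S₂, ∑ c ∈ S₃, ∑ a ∈ S₁, X a b c := by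
  rw [Finset.sum_comm]; exact Finset.sum_congr rfl fun _ _ => Finset.sum_comm

/-- Moving an outer sum inside three sums. -/
private theorem sum₄_comm {α β γ η : Type*} (S₁ : Finset α) (S₂ : Finset β) (S₃ : Finset γ) (S₄ : Finset η)
    (X : α → β → γ → η → ℝ) : ∑ a ∈ S₁, ∑ b ∈ S₂, ∑ c ∈ S₃, ∑ d ∈ S₄, X a b c d =
      ∑ b ∈ S₂, ∑ c ∈ S₃, ∑ d ∈ S₄, ∑ a ∈ S₁, X a b c d := by
  rw [sum₃_comm]; exact Finset.sum_congr rfl fun _ _ => Finset.sum_congr rfl fun _ _ => Finset.sum_comm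

/-- The product-kernel transport preserves the total apart mass. -/
private theorem sum_transport {p q : ι} (hpq : p ≠ q) (f : ι → ℝ) (X : ι → ι → ℝ) :
    ∑ i, ∑ j, ∑ i', ∑ j', X i' j' * (kstep p q f i' i * kstep p q f j' j) = ∑ i', ∑ j', X i' j' := by
  rw [sum₄_comm, sum₄_comm]
  simp only [← Finset.mul_sum, sum_kstep hpq, mul_one]

/-- THE TOGETHER MARGINAL OF ONE EVENT SUMMED OVER THE PARTICLES: untouched mass, the two hosts with the no-split
factor `(1 − f)² + f²`, and the re-merge flow. -/
private theorem sum_sT_stepT {p q : ι} (hpq : p ≠ q) (f : ι → ℝ) {δ : ι → ℕ} (hδ : ∀ i, δ i ≤ 1) {U : ℕ}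
    (hU : 1 ≤ U) (G : ℕ) {T : ι → ℕ → ℕ → ℝ} (A : ι → ι → ℕ → ℕ → ℕ → ℝ) (hTt : ∀ i s, T i s (U - 1) = 0) :
    ∑ i, sT U (stepT p q f δ G T A) i = ∑ i, (if i = p ∨ i = q then 0 else sT U T i) +
      ((1 - f p) ^ 2 + f p ^ 2) * sT U T p + ((1 - f q) ^ 2 + f q ^ 2) * sT U T q +
        ∑ i, ∑ i', ∑ j', sA U G A i' j' * (kstep p q f i' i * kstep p q f j' i) := by
  simp_rw [sT_stepT hpq f hδ hU G hTt, Finset.sum_add_distrib, ← Finset.sum_mul, sum_kstep_sq_fst hpq,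
    sum_kstep_sq_snd hpq]

/-- THE APART MARGINAL OF ONE EVENT SUMMED OVER THE PAIRS (`c₀ ≤ G`): all the apart mass but the re-merge flow, plus
the split mass `2 f (1 − f)` of the two hosts. -/
private theorem sum_sA_stepA {p q : ι} (hpq : p ≠ q) (f : ι → ℝ) {δ : ι → ℕ} (hδ : ∀ i, δ i ≤ 1) {U : ℕ}
    (hU : 1 ≤ U) {G c₀ : ℕ} (hc₀ : c₀ ≤ G) {T : ι → ℕ → ℕ → ℝ} (A : ι → ι → ℕ → ℕ → ℕ → ℝ)
    (hTs : ∀ i t, T i (U - 1) t = 0) (hTt : ∀ i s, T i s (U - 1) = 0) :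
    ∑ i, ∑ j, sA U G (stepA p q f δ c₀ T A) i j =
      ∑ i, ∑ j, sA U G A i j - ∑ i, ∑ i', ∑ j', sA U G A i' j' * (kstep p q f i' i * kstep p q f j' i) +
        2 * f p * (1 - f p) * sT U T p + 2 * f q * (1 - f q) * sT U T q := by
  simp_rw [sA_stepA hpq f hδ hU hc₀ hTs hTt]
  rw [sum_offdiag]
  simp only [Finset.sum_add_distrib]
  rw [sum_transport hpq]
  simp only [← Finset.mul_sum, ← pow_two, sum_kstep hpq, mul_one, sum_kstep_sq_fst hpq, sum_kstep_sq_snd hpq]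
  ring

/-- THE GEOMETRIC SUPERMARTINGALE, one event: with `λ ∈ [0,1]`, `ρ ∈ (0,1]`, nonnegative profiles supported away from the top
marks, fractions in `[0,1]`, score increments `≤ 1` only at the reflected pair, and the SCORE CONDITION
`(1 − f)² + f² + 2 f (1 − f) λ ≤ ρ` at a scoring host, the total weight does not increase: the factor of a together pair is
`ρ^{−δ} ((1 − f)² + f² + 2 f (1 − f) λ) ≤ 1`, apart pairs and re-merges are weight-neutral. [folklore] -/
theorem weight_step {p q : ι} (hpq : p ≠ q) {f : ι → ℝ} (hp0 : 0 ≤ f p) (hp1 : f p ≤ 1) (hq0 : 0 ≤ f q) (hq1 : f q ≤ 1)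
    {δ : ι → ℕ} (hδ : ∀ i, δ i ≤ 1) (hδpq : ∀ i, i ≠ p → i ≠ q → δ i = 0)
    {lam rho : ℝ} (hlam0 : 0 ≤ lam) (hlam1 : lam ≤ 1) (hrho0 : 0 < rho) (_hrho1 : rho ≤ 1)
    {U : ℕ} (hU : 1 ≤ U) (G c₀ : ℕ) {T : ι → ℕ → ℕ → ℝ} {A : ι → ι → ℕ → ℕ → ℕ → ℝ}
    (hT0 : ∀ i s t, 0 ≤ T i s t) (_hA0 : ∀ i j s t g, 0 ≤ A i j s t g)
    (hTs : ∀ i t, T i (U - 1) t = 0) (hTt : ∀ i s, T i s (U - 1) = 0)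
    (_hAg : ∀ i j s t g, G < g → A i j s t g = 0)
    (hscore : ∀ i, δ i = 1 → (1 - f i) ^ 2 + f i ^ 2 + 2 * f i * (1 - f i) * lam ≤ rho) :
    wT lam rho U (stepT p q f δ G T A) + wA lam rho U G (stepA p q f δ c₀ T A) ≤ wT lam rho U T + wA lam rho U G A := by
  -- the weighted profiles: `W` before the event; `T₁` (scored), `T₂` (scored and split), `A₁` after it
  obtain ⟨W, hW⟩ : ∃ W : ι → ℕ → ℕ → ℝ, ∀ i s t, W i s t = lam ^ s * rho⁻¹ ^ t * T i s t := ⟨_, fun _ _ _ => rfl⟩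
  obtain ⟨T₁, hT₁⟩ : ∃ T₁ : ι → ℕ → ℕ → ℝ, ∀ i s t, T₁ i s t = rho⁻¹ ^ δ i * (lam ^ s * rho⁻¹ ^ t * T i s t) :=
    ⟨_, fun _ _ _ => rfl⟩
  obtain ⟨T₂, hT₂⟩ : ∃ T₂ : ι → ℕ → ℕ → ℝ, ∀ i s t, T₂ i s t = lam * T₁ i s t := ⟨_, fun _ _ _ => rfl⟩
  obtain ⟨A₁, hA₁⟩ : ∃ A₁ : ι → ι → ℕ → ℕ → ℕ → ℝ, ∀ i j s t g, A₁ i j s t g = lam ^ s * rho⁻¹ ^ t * A i j s t g :=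
    ⟨_, fun _ _ _ _ _ => rfl⟩
  have hpow : ∀ {d t : ℕ}, d ≤ t → rho⁻¹ ^ t = rho⁻¹ ^ d * rho⁻¹ ^ (t - d) := fun h => by
    rw [← pow_add, Nat.add_sub_cancel' h]
  have keyT : ∀ i s t, lam ^ s * rho⁻¹ ^ t * stepT p q f δ G T A i s t = stepT p q f δ G T₁ A₁ i s t := by
    intro i s t
    refine mul_stepT p q f δ G (fun h => ?_) (fun h => ?_) (fun h => ?_) fun i' j' g => by rw [hA₁]; ring
    · obtain ⟨hp, hq⟩ := not_or.1 h
      rw [hT₁, hδpq i hp hq, pow_zero, one_mul]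
    all_goals rw [hT₁, hpow h]; ring
  have keyA : ∀ i j s t g,
      lam ^ s * rho⁻¹ ^ t * stepA p q f δ c₀ T A i j s t g = stepA p q f δ c₀ T₂ A₁ i j s t g := by
    intro i j s t g
    refine mul_stepA p q f δ c₀ (fun i' j' => by rw [hA₁]; ring) (fun hs h => ?_) fun hs h => ?_
    all_goals
      rw [hT₂, hT₁, hpow h, show lam ^ s = lam * lam ^ (s - 1) by rw [← pow_succ', Nat.sub_add_cancel hs.2]]; ring
  have hT₁t : ∀ i s, T₁ i s (U - 1) = 0 := fun i s => by simp [hT₁, hTt]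
  have hT₂s : ∀ i t, T₂ i (U - 1) t = 0 := fun i t => by simp [hT₂, hT₁, hTs]
  have hT₂t : ∀ i s, T₂ i s (U - 1) = 0 := fun i s => by simp [hT₂, hT₁t]
  have e1 : wT lam rho U (stepT p q f δ G T A) = ∑ i, sT U (stepT p q f δ G T₁ A₁) i := by simp only [wT, sT, keyT]
  have e2 : wA lam rho U G (stepA p q f δ c₀ T A) = ∑ i, ∑ j, sA U G (stepA p q f δ c₀ T₂ A₁) i j := by
    simp only [wA, sA, keyA]
  have e3 : wT lam rho U T = ∑ i, sT U W i := by simp only [wT, sT, hW]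
  have e4 : wA lam rho U G A = ∑ i, ∑ j, sA U G A₁ i j := by simp only [wA, sA, hA₁]
  -- host data in terms of the weighted together mass `sT U W` before the event
  have hW0 : ∀ i, 0 ≤ sT U W i := fun i => Finset.sum_nonneg fun s _ => Finset.sum_nonneg fun t _ => by
    rw [hW]; exact mul_nonneg (mul_nonneg (pow_nonneg hlam0 _) (pow_nonneg (inv_nonneg.2 hrho0.le) _)) (hT0 i s t)
  have hT₁W : ∀ i, sT U T₁ i = rho⁻¹ ^ δ i * sT U W i := fun i => by simp only [sT, hT₁, hW, Finset.mul_sum]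
  have hT₂W : ∀ i, sT U T₂ i = lam * (rho⁻¹ ^ δ i * sT U W i) := fun i => by
    rw [← hT₁W]; simp only [sT, hT₂, Finset.mul_sum]
  have hrest : ∑ i, (if i = p ∨ i = q then 0 else sT U T₁ i) = ∑ i, sT U W i - sT U W p - sT U W q := by
    rw [← sum_ite_pq hpq]
    refine Finset.sum_congr rfl fun i _ => ?_
    split_ifs with h
    · rfl
    · obtain ⟨hp, hq⟩ := not_or.1 h
      rw [hT₁W, hδpq i hp hq, pow_zero, one_mul]
  -- the host factor `ρ^{-δ} ((1 − f)² + f² + 2 f (1 − f) λ) ≤ 1`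
  have hfac : ∀ {x : ℝ} {d : ℕ}, 0 ≤ x → x ≤ 1 → d ≤ 1 → (d = 1 → (1 - x) ^ 2 + x ^ 2 + 2 * x * (1 - x) * lam ≤ rho) →
      ∀ {w : ℝ}, 0 ≤ w → ((1 - x) ^ 2 + x ^ 2) * (rho⁻¹ ^ d * w) + 2 * x * (1 - x) * (lam * (rho⁻¹ ^ d * w)) ≤ w ∧
        0 ≤ 2 * x * (1 - x) * (lam * (rho⁻¹ ^ d * w)) := by
    intro x d hx0 hx1 hd hsc w hw
    have hx : 0 ≤ 2 * x * (1 - x) := mul_nonneg (mul_nonneg zero_le_two hx0) (sub_nonneg.2 hx1)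
    have hr : 0 ≤ rho⁻¹ ^ d * w := mul_nonneg (pow_nonneg (inv_nonneg.2 hrho0.le) _) hw
    refine ⟨?_, mul_nonneg hx (mul_nonneg hlam0 hr)⟩
    have h1 : rho⁻¹ ^ d * ((1 - x) ^ 2 + x ^ 2 + 2 * x * (1 - x) * lam) ≤ 1 := by
      interval_cases d
      · rw [pow_zero, one_mul]; nlinarith [mul_nonneg hx (sub_nonneg.2 hlam1)]
      · rw [pow_one, inv_mul_le_one₀ hrho0]; exact hsc rfl
    nlinarith [mul_le_mul_of_nonneg_right h1 hw]
  have hR : ∑ i, ∑ j, sA U G (stepA p q f δ c₀ T₂ A₁) i j ≤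
      ∑ i, ∑ j, sA U G A₁ i j - ∑ i, ∑ i', ∑ j', sA U G A₁ i' j' * (kstep p q f i' i * kstep p q f j' i) +
        2 * f p * (1 - f p) * sT U T₂ p + 2 * f q * (1 - f q) * sT U T₂ q := by
    by_cases hc : c₀ ≤ G
    · exact (sum_sA_stepA hpq f hδ hU hc A₁ hT₂s hT₂t).le
    -- `c₀ > G`: the split mass leaves the summation box, the old tags are only transported
    rw [show (sA U G : (ι → ι → ℕ → ℕ → ℕ → ℝ) → ι → ι → ℝ) = sAle U G from rfl]
    simp_rw [sAle_stepA hpq f δ (not_le.1 hc) U T₂ A₁, sum_offdiag, sum_transport hpq, hT₂W]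
    linarith [(hfac hp0 hp1 (hδ p) (hscore p) (hW0 p)).2, (hfac hq0 hq1 (hδ q) (hscore q) (hW0 q)).2]
  rw [hT₂W p, hT₂W q] at hR
  rw [e1, e2, e3, e4, sum_sT_stepT hpq f hδ hU G A₁ hT₁t, hrest, hT₁W p, hT₁W q]
  linarith [(hfac hp0 hp1 (hδ p) (hscore p) (hW0 p)).1, (hfac hq0 hq1 (hδ q) (hscore q) (hW0 q)).1]

/-! ### §SM The split moment: `Σ s·(together) + Σ (s−1)·(apart)` grows exactly by the re-merge flow -/

/-- First moment of the split mark on together mass. -/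
def smT (U : ℕ) (T : ι → ℕ → ℕ → ℝ) : ℝ :=
  ∑ i, ∑ s ∈ Finset.range U, ∑ t ∈ Finset.range U, (s : ℝ) * T i s t

/-- First moment of (split mark − 1) on apart mass. -/
def smA (U G : ℕ) (A : ι → ι → ℕ → ℕ → ℕ → ℝ) : ℝ :=
  ∑ i, ∑ j, ∑ s ∈ Finset.range U, ∑ t ∈ Finset.range U, ∑ g ∈ Finset.range (G + 1), ((s : ℝ) - 1) * A i j s t g

/-- The RE-MERGE FLOW of one event: apart mass whose two tracers land on the same particle. -/
def remFlow (p q : ι) (f : ι → ℝ) (U G : ℕ) (A : ι → ι → ℕ → ℕ → ℕ → ℝ) : ℝ :=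
  ∑ i, ∑ i', ∑ j', sA U G A i' j' * (kstep p q f i' i * kstep p q f j' i)

/-- SPLIT-MOMENT IDENTITY, one event: a split moves mass from `(together, s)` to `(apart, s+1)` — neutral for
`s·T + (s−1)·A` —, a re-merge moves `(apart, s)` to `(together, s)` — a gain of exactly its mass —, transport is neutral. [folklore] -/
theorem splitMoment_step {p q : ι} (hpq : p ≠ q) (f : ι → ℝ) {δ : ι → ℕ} (hδ : ∀ i, δ i ≤ 1) {U : ℕ} (hU : 1 ≤ U)
    {G c₀ : ℕ} (hc₀ : c₀ ≤ G) {T : ι → ℕ → ℕ → ℝ} {A : ι → ι → ℕ → ℕ → ℕ → ℝ}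
    (hTs : ∀ i t, T i (U - 1) t = 0) (hTt : ∀ i s, T i s (U - 1) = 0) (_hAdiag : ∀ i s t g, A i i s t g = 0) :
    smT U (stepT p q f δ G T A) + smA U G (stepA p q f δ c₀ T A) = smT U T + smA U G A + remFlow p q f U G A := by
  -- the moment profiles: `T₁ = s·T`, `A₁ = s·A`, `A₀ = (s−1)·A`
  obtain ⟨T₁, hT₁⟩ : ∃ T₁ : ι → ℕ → ℕ → ℝ, ∀ i s t, T₁ i s t = (s : ℝ) * T i s t := ⟨_, fun _ _ _ => rfl⟩
  obtain ⟨A₁, hA₁⟩ : ∃ A₁ : ι → ι → ℕ → ℕ → ℕ → ℝ, ∀ i j s t g, A₁ i j s t g = (s : ℝ) * A i j s t g :=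
    ⟨_, fun _ _ _ _ _ => rfl⟩
  obtain ⟨A₀, hA₀⟩ : ∃ A₀ : ι → ι → ℕ → ℕ → ℕ → ℝ, ∀ i j s t g, A₀ i j s t g = ((s : ℝ) - 1) * A i j s t g :=
    ⟨_, fun _ _ _ _ _ => rfl⟩
  have keyT : ∀ (i : ι) (s t : ℕ), (s : ℝ) * stepT p q f δ G T A i s t = stepT p q f δ G T₁ A₁ i s t := fun i s t =>
    mul_stepT p q f δ G (fun _ => (hT₁ i s t).symm) (fun _ => by rw [hT₁]; ring) (fun _ => by rw [hT₁]; ring)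
      fun _ _ _ => by rw [hA₁]; ring
  have keyA : ∀ (i j : ι) (s t g : ℕ),
      ((s : ℝ) - 1) * stepA p q f δ c₀ T A i j s t g = stepA p q f δ c₀ T₁ A₀ i j s t g := by
    intro i j s t g
    refine mul_stepA p q f δ c₀ (fun _ _ => by rw [hA₀]; ring) (fun hs _ => ?_) fun hs _ => ?_
    all_goals rw [hT₁, Nat.cast_sub hs.2, Nat.cast_one]; ring
  have hT₁s : ∀ i t, T₁ i (U - 1) t = 0 := fun i t => by simp [hT₁, hTs]
  have hT₁t : ∀ i s, T₁ i s (U - 1) = 0 := fun i s => by simp [hT₁, hTt]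
  have e1 : smT U (stepT p q f δ G T A) = ∑ i, sT U (stepT p q f δ G T₁ A₁) i := by simp only [smT, sT, keyT]
  have e2 : smA U G (stepA p q f δ c₀ T A) = ∑ i, ∑ j, sA U G (stepA p q f δ c₀ T₁ A₀) i j := by
    simp only [smA, sA, keyA]
  have e3 : smT U T = ∑ i, sT U T₁ i := by simp only [smT, sT, hT₁]
  have e4 : smA U G A = ∑ i, ∑ j, sA U G A₀ i j := by simp only [smA, sA, hA₀]
  have e5 : ∀ i' j', sA U G A₁ i' j' - sA U G A₀ i' j' = sA U G A i' j' := fun i' j' => by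
    simp only [sA, ← Finset.sum_sub_distrib, hA₁, hA₀]
    exact Finset.sum_congr rfl fun s _ => Finset.sum_congr rfl fun t _ => Finset.sum_congr rfl fun g _ => by ring
  have e6 : ∑ i, ∑ i', ∑ j', sA U G A₁ i' j' * (kstep p q f i' i * kstep p q f j' i) -
      ∑ i, ∑ i', ∑ j', sA U G A₀ i' j' * (kstep p q f i' i * kstep p q f j' i) = remFlow p q f U G A := by
    simp only [remFlow, ← Finset.sum_sub_distrib, ← sub_mul, e5]
  rw [e1, e2, e3, e4, sum_sT_stepT hpq f hδ hU G A₁ hT₁t, sum_sA_stepA hpq f hδ hU hc₀ A₀ hT₁s hT₁t,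
    sum_ite_pq hpq, ← e6]
  ring

/-! ### §DF The score deficit -/

/-- Deficit moment of together mass w.r.t. a resolved-slot count `e` of the hosts: `Σ (e i − t)·T`. -/
def dfT (e : ι → ℝ) (U : ℕ) (T : ι → ℕ → ℕ → ℝ) : ℝ :=
  ∑ i, ∑ s ∈ Finset.range U, ∑ t ∈ Finset.range U, (e i - (t : ℝ)) * T i s t

/-- Frozen deficit moment of apart mass: `Σ (g − t)·A`. -/
def dfA (U G : ℕ) (A : ι → ι → ℕ → ℕ → ℕ → ℝ) : ℝ :=
  ∑ i, ∑ j, ∑ s ∈ Finset.range U, ∑ t ∈ Finset.range U, ∑ g ∈ Finset.range (G + 1), ((g : ℝ) - (t : ℝ)) * A i j s t g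

/-- The re-merge flow of the apart mass carrying a given tag `g`. -/
def remFlowTag (p q : ι) (f : ι → ℝ) (U : ℕ) (A : ι → ι → ℕ → ℕ → ℕ → ℝ) (g : ℕ) : ℝ :=
  ∑ i, ∑ i', ∑ j', (∑ s ∈ Finset.range U, ∑ t ∈ Finset.range U, A i' j' s t g) * (kstep p q f i' i * kstep p q f j' i)

/-- The re-merge flow against a tag weight `φ` is the re-merge flow of the `φ`-weighted apart profile. -/
private theorem sum_mul_remFlowTag (p q : ι) (f : ι → ℝ) (U G : ℕ) (A : ι → ι → ℕ → ℕ → ℕ → ℝ) (φ : ℕ → ℝ) :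
    ∑ g ∈ Finset.range (G + 1), φ g * remFlowTag p q f U A g =
      ∑ i, ∑ i', ∑ j', sA U G (fun i j s t g => φ g * A i j s t g) i' j' * (kstep p q f i' i * kstep p q f j' i) := by
  simp only [remFlowTag, sA, Finset.mul_sum]
  rw [sum₄_comm]
  refine Finset.sum_congr rfl fun i _ => Finset.sum_congr rfl fun i' _ => Finset.sum_congr rfl fun j' _ => ?_
  rw [sum₃_comm, sum₃_comm, Finset.sum_mul]
  refine Finset.sum_congr rfl fun g _ => ?_
  rw [← mul_assoc]
  simp only [← Finset.mul_sum]

omit [Fintype ι] in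
/-- The kernel column of an untouched particle is the identity column. -/
private theorem kstep_col {p q : ι} (f : ι → ℝ) {i : ι} (hp : i ≠ p) (hq : i ≠ q) (r : ι) :
    kstep p q f r i = if i = r then 1 else 0 := by
  unfold kstep
  by_cases hrp : r = p
  · subst hrp; simp [hp, hq]
  by_cases hrq : r = q
  · subst hrq; simp [hp, hq]
  rw [if_neg hrp, if_neg hrq]

/-- DEFICIT IDENTITY, one event: if after the event both hosts of the reflected pair count `c₀` resolved slots and the other
particles keep their count, the deficit changes by `(c₀ − e h − δ h) ×` (together mass at `h`) for the two hosts `h` (the slots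
resolved now minus the score taken now) plus `(c₀ − g) ×` (re-merge flow of tag `g`) (the lag of the re-merging pairs). [folklore] -/
theorem deficit_step {p q : ι} (hpq : p ≠ q) (f : ι → ℝ) {δ : ι → ℕ} (hδ : ∀ i, δ i ≤ 1) {U : ℕ} (hU : 1 ≤ U)
    {G c₀ : ℕ} (hc₀ : c₀ ≤ G) {T : ι → ℕ → ℕ → ℝ} {A : ι → ι → ℕ → ℕ → ℕ → ℝ}
    (hTs : ∀ i t, T i (U - 1) t = 0) (hTt : ∀ i s, T i s (U - 1) = 0) (hAdiag : ∀ i s t g, A i i s t g = 0)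
    {e e' : ι → ℝ} (he' : ∀ i, i ≠ p → i ≠ q → e' i = e i) (hep : e' p = c₀) (heq : e' q = c₀) :
    dfT e' U (stepT p q f δ G T A) + dfA U G (stepA p q f δ c₀ T A) =
      dfT e U T + dfA U G A + ((c₀ : ℝ) - e p - δ p) * sT U T p + ((c₀ : ℝ) - e q - δ q) * sT U T q +
        ∑ g ∈ Finset.range (G + 1), ((c₀ : ℝ) - g) * remFlowTag p q f U A g := by
  -- the deficit profiles: together mass against the count `c₀ − δ` at the hosts (the count after the event minus the
  -- score taken now) and `e` elsewhere; apart mass against `c₀` (re-merging part) and against its tag `g`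
  obtain ⟨T₁, hT₁⟩ : ∃ T₁ : ι → ℕ → ℕ → ℝ,
      ∀ i s t, T₁ i s t = ((if i = p ∨ i = q then (c₀ : ℝ) - δ i else e i) - t) * T i s t := ⟨_, fun _ _ _ => rfl⟩
  obtain ⟨A₁, hA₁⟩ : ∃ A₁ : ι → ι → ℕ → ℕ → ℕ → ℝ, ∀ i j s t g, A₁ i j s t g = ((c₀ : ℝ) - t) * A i j s t g :=
    ⟨_, fun _ _ _ _ _ => rfl⟩
  obtain ⟨A₂, hA₂⟩ : ∃ A₂ : ι → ι → ℕ → ℕ → ℕ → ℝ, ∀ i j s t g, A₂ i j s t g = ((g : ℝ) - t) * A i j s t g :=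
    ⟨_, fun _ _ _ _ _ => rfl⟩
  obtain ⟨D, hD⟩ : ∃ D : ι → ℝ, ∀ i, D i = sT U (fun i s t => (e i - t) * T i s t) i := ⟨_, fun _ => rfl⟩
  have keyT : ∀ i s t, (e' i - t) * stepT p q f δ G T A i s t = stepT p q f δ G T₁ A₁ i s t := by
    intro i s t
    by_cases hi : i = p ∨ i = q
    · have hei : e' i = c₀ := by rcases hi with rfl | rfl <;> assumption
      refine mul_stepT p q f δ G (fun h => absurd hi h) (fun h => ?_) (fun h => ?_) fun i' j' g => ?_
      · rw [hT₁, if_pos (Or.inl rfl), Nat.cast_sub h, hei]; ring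
      · rw [hT₁, if_pos (Or.inr rfl), Nat.cast_sub h, hei]; ring
      · rw [hA₁, hei]; ring
    · obtain ⟨hp, hq⟩ := not_or.1 hi
      refine mul_stepT p q f δ G (fun _ => ?_) (fun _ => ?_) (fun _ => ?_) fun i' j' g => ?_
      · rw [hT₁, if_neg hi, he' i hp hq]
      · rw [kstep_col f hp hq, if_neg hp]; ring
      · rw [kstep_col f hp hq, if_neg hq]; ring
      · rw [kstep_col f hp hq i', kstep_col f hp hq j', hA₁]
        by_cases h₁ : i = i'
        · by_cases h₂ : i = j'
          · subst h₁ h₂; simp [hAdiag]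
          · simp [h₂]
        · simp [h₁]
  have keyA : ∀ (i j : ι) (s t g : ℕ),
      ((g : ℝ) - t) * stepA p q f δ c₀ T A i j s t g = stepA p q f δ c₀ T₁ A₂ i j s t g := by
    intro i j s t g
    refine mul_stepA p q f δ c₀ (fun _ _ => by rw [hA₂]; ring) (fun hs h => ?_) fun hs h => ?_
    · rw [hT₁, if_pos (Or.inl rfl), Nat.cast_sub h, hs.1]; ring
    · rw [hT₁, if_pos (Or.inr rfl), Nat.cast_sub h, hs.1]; ring
  have hT₁s : ∀ i t, T₁ i (U - 1) t = 0 := fun i t => by rw [hT₁, hTs, mul_zero]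
  have hT₁t : ∀ i s, T₁ i s (U - 1) = 0 := fun i s => by rw [hT₁, hTt, mul_zero]
  have e1 : dfT e' U (stepT p q f δ G T A) = ∑ i, sT U (stepT p q f δ G T₁ A₁) i := by simp only [dfT, sT, keyT]
  have e2 : dfA U G (stepA p q f δ c₀ T A) = ∑ i, ∑ j, sA U G (stepA p q f δ c₀ T₁ A₂) i j := by
    simp only [dfA, sA, keyA]
  have e0 : dfT e U T = ∑ i, D i := by simp only [dfT, sT, hD]
  have e4 : dfA U G A = ∑ i, ∑ j, sA U G A₂ i j := by simp only [dfA, sA, hA₂]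
  have e3 : ∑ i, (if i = p ∨ i = q then 0 else sT U T₁ i) = ∑ i, D i - D p - D q := by
    rw [← sum_ite_pq hpq]
    refine Finset.sum_congr rfl fun i _ => ?_
    split_ifs with h
    · rfl
    · simp only [hD, sT, hT₁, if_neg h]
  have e5 : ∀ {r}, r = p ∨ r = q → sT U T₁ r = D r + ((c₀ : ℝ) - e r - δ r) * sT U T r := fun hr => by
    simp only [hD, sT, hT₁, if_pos hr, Finset.mul_sum, ← Finset.sum_add_distrib]
    exact Finset.sum_congr rfl fun s _ => Finset.sum_congr rfl fun t _ => by ring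
  have e7 : ∑ i, ∑ i', ∑ j', sA U G A₁ i' j' * (kstep p q f i' i * kstep p q f j' i) -
      ∑ i, ∑ i', ∑ j', sA U G A₂ i' j' * (kstep p q f i' i * kstep p q f j' i) =
      ∑ g ∈ Finset.range (G + 1), ((c₀ : ℝ) - g) * remFlowTag p q f U A g := by
    rw [sum_mul_remFlowTag]
    simp only [← Finset.sum_sub_distrib, ← sub_mul]
    refine Finset.sum_congr rfl fun i _ => Finset.sum_congr rfl fun i' _ => Finset.sum_congr rfl fun j' _ => ?_
    congr 1
    simp only [sA, hA₁, hA₂, ← Finset.sum_sub_distrib]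
    exact Finset.sum_congr rfl fun s _ => Finset.sum_congr rfl fun t _ => Finset.sum_congr rfl fun g _ => by ring
  rw [e1, e2, e0, e4, sum_sT_stepT hpq f hδ hU G A₁ hT₁t, sum_sA_stepA hpq f hδ hU hc₀ A₂ hT₁s hT₁t, e3,
    e5 (Or.inl rfl), e5 (Or.inr rfl), ← e7]
  ring

/-- The flows by tag add up to the re-merge flow. [folklore] -/
theorem sum_remFlowTag (p q : ι) (f : ι → ℝ) (U G : ℕ) (A : ι → ι → ℕ → ℕ → ℕ → ℝ) :
    ∑ g ∈ Finset.range (G + 1), remFlowTag p q f U A g = remFlow p q f U G A := by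
  simpa only [one_mul, remFlow] using sum_mul_remFlowTag p q f U G A fun _ => 1

/-- REGISTERED HEADLINE (sub-goal `pairPath_weight_step`): the supermartingale step at `ι = Fin (N+1)`. [folklore] -/
theorem pairPath_weight_step : ∀ (N : ℕ) (p q : Fin (N + 1)), p ≠ q → ∀ (f : Fin (N + 1) → ℝ), 0 ≤ f p → f p ≤ 1 → 0 ≤ f q → f q ≤ 1 → ∀ (δ : Fin (N + 1) → ℕ), (∀ i, δ i ≤ 1) → (∀ i, i ≠ p → i ≠ q → δ i = 0) → ∀ (lam rho : ℝ), 0 ≤ lam → lam ≤ 1 → 0 < rho → rho ≤ 1 → ∀ (U : ℕ), 1 ≤ U → ∀ (G c₀ : ℕ) (T : Fin (N + 1) → ℕ → ℕ → ℝ) (A : Fin (N + 1) → Fin (N + 1) → ℕ → ℕ → ℕ → ℝ), (∀ i s t, 0 ≤ T i s t) → (∀ i j s t g, 0 ≤ A i j s t g) → (∀ i t, T i (U - 1) t = 0) → (∀ i s, T i s (U - 1) = 0) → (∀ i j s t g, G < g → A i j s t g = 0) → (∀ i, δ i = 1 → (1 - f i) ^ 2 + f i ^ 2 + 2 * f i *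 (1 - f i) * lam ≤ rho) → PairPath.wT lam rho U (PairPath.stepT p q f δ G T A) + PairPath.wA lam rho U G (PairPath.stepA p q f δ c₀ T A) ≤ PairPath.wT lam rho U T + PairPath.wA lam rho U G A :=
  fun _ _ _ hpq _ hp0 hp1 hq0 hq1 _ hδ hδpq _ _ hl0 hl1 hr0 hr1 _ hU G c₀ _ _ hT0 hA0 hTs hTt hAg hsc =>
    weight_step hpq hp0 hp1 hq0 hq1 hδ hδpq hl0 hl1 hr0 hr1 hU G c₀ hT0 hA0 hTs hTt hAg hsc

end GenericLemmas

end PairPath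

end

end Summit.AtomisticToContinuum.HydrodynamicLimit.Theorems.DiffuseBackwardInfluenceShare
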